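import Mathlib.Tactic
import Literature.MathematicalPhysics.MHD.TearingOuterRegion
import Literature.MathematicalPhysics.MHD.ResistiveWallMode

/-!
# Resistive-MHD margin STATEMENT SCHEMAS (LADDER-GRIDFUSION rung F3, model row 6) — slim version

Venture `Ventures/FusionMHD`, module `Models/ResistiveSchemas`. The as-printed OBJECTS (outer-region
tearing equations, `Δ′`, thin-wall RWM dispersion form, flat-current RWM model) live in
`Literature.MathematicalPhysics.MHD.{Tearing, ResistiveWall}` (p458687, p458701); this file keeps only the
ladder vocabulary: what «margin `m` for equilibrium `e` against perturbation class `C`» means as a typed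
`Prop` (`MarginSchema`), and the two schema instances `tearingSchema` (criterion «`Δ′ < 0` on every resonant
`(m,n)`», FKR as printed [cite: Schnack2009, Lect. 34 eq. (34.15)], [cite: Miyamoto2007, §9.1 eq. (9.24)])
and `rwmNoWallSchema` / `rwmIdealWallSchema` ([cite: Freidberg2014, §11.5.6]). No physics theorem; no claim
about any device: every schema is about a named MODEL `M` and CLASS `C` (three-column rule). See
HOME/models/F3-SCOPING.md for the reduction table.
-/

noncomputable section

open Set Filter
open scoped Topology

namespace Summit.Ventures.FusionMHD.Models.ResistiveSchemas

open Literature.MathematicalPhysics.MHD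

/-! ## 1. Margin schemas: «margin `m` for `e` against class `C`» as a Prop -/

/-- A **margin schema** for equilibria of type `E` and mode labels of type `ι`: for each equilibrium
`e`, the set `admissible e` of modes of the perturbation class that apply to `e` (e.g. the resonant
`(m,n)` with a rational surface `q(r_s) = m/n` inside the plasma), and a real **margin functional**
`μ e i` whose SIGN CONVENTION is: the printed stability criterion of the model for mode `i` reads
`0 < μ e i` (e.g. `μ = −Δ′_{m,n}` for tearing, `μ = δW_∞` for the no-wall external kink / RWM).
MODELLED: the schema names a model and a printed criterion; it asserts nothing by itself. [folklore] -/
structure MarginSchema (E : Type*) (ι : Type*) where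
  /-- modes of the class that apply to the equilibrium `e` -/
  admissible : E → Set ι
  /-- the margin functional; criterion for mode `i` is `0 < μ e i` -/
  μ : E → ι → ℝ

namespace MarginSchema

variable {E ι : Type*} (S : MarginSchema E ι)

/-- «Equilibrium `e` has margin at least `m` against the class»: every admissible mode has
`m ≤ μ e i`. This is the typed meaning of «margin m for configuration E against class C»
(LADDER-GRIDFUSION F3); a CERTIFIED instance is a kernel proof of this Prop for an explicit
rational `m` obtained from enclosures of `μ`. [folklore] -/
def HasMargin (e : E) (m : ℝ) : Prop := ∀ i ∈ S.admissible e, m ≤ S.μ e i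

/-- «The printed criterion holds for `e` on the whole class»: `0 < μ e i` for every admissible mode.
[folklore] -/
def CriterionHolds (e : E) : Prop := ∀ i ∈ S.admissible e, 0 < S.μ e i

/-- «Certified positive margin»: some explicit `m > 0` bounds the margin functional from below on the
class. [folklore] -/
def HasPositiveMargin (e : E) : Prop := ∃ m : ℝ, 0 < m ∧ S.HasMargin e m

variable {S}

/-- A positive margin implies the printed criterion on the whole class. [folklore] -/
theorem criterionHolds_of_hasMargin {e : E} {m : ℝ} (hm : 0 < m) (h : S.HasMargin e m) :
    S.CriterionHolds e :=
  fun i hi ↦ lt_of_lt_of_le hm (h i hi)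

/-- Margins are monotone: a margin `m` is also a margin `m' ≤ m`. [folklore] -/
theorem HasMargin.mono {e : E} {m m' : ℝ} (h : S.HasMargin e m) (hle : m' ≤ m) :
    S.HasMargin e m' :=
  fun i hi ↦ le_trans hle (h i hi)

/-- `HasPositiveMargin` implies `CriterionHolds`. [folklore] -/
theorem criterionHolds_of_hasPositiveMargin {e : E} (h : S.HasPositiveMargin e) :
    S.CriterionHolds e := by
  obtain ⟨m, hm, h⟩ := h; exact criterionHolds_of_hasMargin hm h

/-- On a FINITE admissible class the converse holds: the criterion gives a positive margin
(the minimum of finitely many positive numbers). [folklore] -/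
theorem hasPositiveMargin_of_criterionHolds_finite {e : E} (hfin : (S.admissible e).Finite)
    (h : S.CriterionHolds e) : S.HasPositiveMargin e := by
  classical
  by_cases hne : (S.admissible e).Nonempty
  · have hne' : hfin.toFinset.Nonempty := by simpa using hne
    obtain ⟨i₀, hi₀, hmin⟩ := hfin.toFinset.exists_min_image (S.μ e) hne'
    have hi₀' : i₀ ∈ S.admissible e := by simpa using hi₀
    exact ⟨S.μ e i₀, h i₀ hi₀', fun i hi ↦ hmin i (by simpa using hi)⟩
  · refine ⟨1, one_pos, fun i hi ↦ ?_⟩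
    exact absurd ⟨i, hi⟩ hne

end MarginSchema

/-! ## 2. The `Δ′ < 0` schema (objects: `Literature.MathematicalPhysics.MHD.Tearing`) -/

/-- **Tearing data of an equilibrium in a single-helicity outer model**: the set of resonant mode
labels `(m,n)` (those with a rational surface `q(r_s) = m/n` in the plasma) and, for each, the
dimensionless index `r_s Δ′_{m,n}` of the outer solution regular at the axis and satisfying the
wall/edge condition. How `deltaPrime` is OBTAINED (validated ODE + Frobenius patch, F3-SCOPING §R1)
is not part of the schema; a certificate supplies an enclosure of it. [folklore] -/
structure TearingData where
  /-- resonant `(m,n)` with a rational surface inside the plasma -/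
  resonant : Set (ℤ × ℤ)
  /-- the (dimensionless, `r_s`-normalised) tearing index `Δ′_{m,n}` -/
  deltaPrime : ℤ × ℤ → ℝ

/-- **The `Δ′ < 0` schema.** Margin functional `μ = −Δ′_{m,n}` on the resonant class: the printed
criterion of the asymptotic-matching models is «instability iff `Δ′ > 0`» («a famous result first
obtained in FKR») [cite: Schnack2009, Lect. 34 eq. (34.15) p. 208], [cite: Miyamoto2007, §9.1 eq. (9.24)
p. 223], [cite: Bateman1978, §10.2 eq. (10.2.25) p. 202 («necessary prerequisite»)]; original
[cite: FurthKilleenRosenbluth1963, §V]. Hence `CriterionHolds` = «`Δ′_{m,n} < 0` for every resonant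
`(m,n)`» = linear tearing stability OF MODEL M_FKR (zero-β, constant-ψ). At finite pressure with
favourable average curvature the printed threshold moves to `Δ′ > Δ′_c > 0` (GGJ 1975, as restated in
[cite: HamEtAl2013, §1 p. 3–4]; [cite: Schnack2009, Lect. 35 p. 217 «toroidal: `Δ′ > Δ′_C > 0`»]),
so `Δ′ < 0` remains SUFFICIENT there — the schema is conservative, like an inner ROA estimate.
The Literature named fact for the criterion itself is lit-3's row A11 (`…MHD.Tearing`, staged). -/
def tearingSchema : MarginSchema TearingData (ℤ × ℤ) where
  admissible d := d.resonant
  μ d i := -d.deltaPrime i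

/-- Unfolding: the tearing criterion holds iff every resonant `Δ′` is negative. [folklore] -/
theorem tearingSchema_criterionHolds_iff (d : TearingData) :
    tearingSchema.CriterionHolds d ↔ ∀ i ∈ d.resonant, d.deltaPrime i < 0 := by
  simp [MarginSchema.CriterionHolds, tearingSchema]
/-- Unfolding: margin `m` against tearing iff `Δ′_{m,n} ≤ −m` on the resonant class. [folklore] -/
theorem tearingSchema_hasMargin_iff (d : TearingData) (m : ℝ) :
    tearingSchema.HasMargin d m ↔ ∀ i ∈ d.resonant, d.deltaPrime i ≤ -m := by
  simp [MarginSchema.HasMargin, tearingSchema, le_neg]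

/-! ## 3. RWM schemas (objects: `Literature.MathematicalPhysics.MHD.ResistiveWall`) -/

/-- **RWM / external-kink data in the thin-wall cylindrical model**: admissible external modes and,
per mode, the two printed reference energies `δW_∞` (no wall) and `δW_b` (ideal wall at `b`).
[folklore] -/
structure RWMData (ι : Type*) where
  /-- external mode labels considered (e.g. `(m,n)` with `m/n > q_a`) -/
  modes : Set ι
  /-- ideal energy with the wall at infinity -/
  dWinf : ι → ℝ
  /-- ideal energy with a perfectly conducting wall at `r = b` -/
  dWb : ι → ℝ

/-- **No-wall schema** (`μ = δW_∞`): by the printed dispersion relation a resistive wall does not change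
the sign boundary — «the stability boundary reverts back to the one with the wall at infinity»
[cite: Freidberg2014, §11.5.6 p. 492] — so RWM-class stability OF THE MODEL is `δW_∞ > 0` on every
admissible mode. [folklore] -/
def rwmNoWallSchema (ι : Type*) : MarginSchema (RWMData ι) ι where
  admissible d := d.modes
  μ d i := d.dWinf i

/-- **Ideal-wall schema** (`μ = δW_b`): stability with a PERFECTLY conducting wall at `b`; relevant to
the RWM only as the condition under which the residual growth is on the slow wall time (feedback
regime) [cite: Freidberg2014, §11.5.6 p. 487]. MODELLED: ideal wall. [folklore] -/
def rwmIdealWallSchema (ι : Type*) : MarginSchema (RWMData ι) ι where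
  admissible d := d.modes
  μ d i := d.dWb i

end Summit.Ventures.FusionMHD.Models.ResistiveSchemas

end
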